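import Summits.AnomalousDissipation.AnomalousDissipation.Theorems.GalerkinSteadyZerothLaw.Negative.StokesStates
import Literature.Analysis.FluidPDE.NSGalerkinStationary

/-!
# Tier B (continued) of the stub plan for `stub_loudCoatDecades` (line `idea-sketch-ideator2`),
# crux stmt-AnomalousDissipation-2986 (`MirrorVariety.GalerkinSteadyZerothLaw`): the coat window (GENERAL core)

`STUB-PLAN-stub_loudCoatDecades.md` §2.2 tier B, lemma B2 (k3-H6), the tightness lemma behind kill criterion K-1
("instant budget check", and "no small loud coats").  For an exact Euler core `C = Cfun|modes N` (support of
`Cfun` in `modes K₀`, `K₀ ≤ N`) and an amplitude-clamped coat `h ⊥ C` at clamp viscosity `ν ≥ 0`: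

* `coat_pairing` — pairing the coat equation with `h`: `dissipation ν h + ν·4π² ∑|k|² Re⟪C k, h k⟫ = -∫⟪h̃, (h̃·∇)C̃⟫`
  (general core; the Leray symbol drops against the transversal `h k`, Parseval against the band-limited `h̃`,
  antisymmetry of the trilinear form, and the core's exactness tested against `h̃`);
* `norm_convect_realTrigPoly_le` — the explicit `ℓ¹` strain bound
  `‖(u·∇) realTrigPoly S c (x)‖ ≤ (2π ∑_{k∈S} |k| ‖c k‖) ‖u x‖`;
* `coat_window` (B2): `energy (C + h) = energy C + energy h` and
  `dissipation ν (C + h) ≤ (2π ∑_{modes K₀} |k| ‖Cfun k‖) · energy h + 2ν·4π²K₀² (√(energy C) + √(energy h))²`.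

The closing `stub_loudCoatWindowTools` is the REGISTERED packaging of B2 (the plan's `strainBound` inlined).
References: Temam, *Navier–Stokes Equations*, Ch. II §1.2 Lemma 1.3; Robinson–Rodrigo–Sadowski 2016, (4.5).
-/

noncomputable section

-- `Summit.<Summit>.<Problem>` is the tree's mandated summit-side namespace (CONVENTIONS §2); deliberate duplicate.
set_option linter.dupNamespace false

open scoped InnerProductSpace
open MeasureTheory Filter Set UnitAddTorus
open Literature.Analysis.FunctionSpaces Literature.Analysis.FunctionSpaces.Torus
open Literature.Analysis.FluidPDE Literature.Analysis.FluidPDE.Torus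

namespace Summit.AnomalousDissipation.AnomalousDissipation.Theorems.GalerkinSteadyZerothLaw

open Summit.AnomalousDissipation.AnomalousDissipation.Theorems.GalerkinSteadyZerothLaw.Negative
  (fieldOf integral_norm_sq_fieldOf)
open Summit.AnomalousDissipation.AnomalousDissipation.Theorems.LaminarNeverLoud.Negative
  (modes energy dissipation modes_symm energy_nonneg freqNormSq_le_of_mem_modes)

/-! ## §1 The pairing identity (general core) -/

/-- **Pairing the coat equation with the coat** (GENERAL exact Euler core).  If `Π_N B(C, C) = 0`, `h` is real
solenoidal and `ℓ²`-orthogonal to `C`, and `galerkinRHS (modes N) ν 0 (C + h) = (-s) • C`, then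
`dissipation ν h + ν·4π² ∑_k |k|² Re⟪C k, h k⟫ = -∫ ⟪h̃, (h̃·∇)C̃⟫` (`h̃ = fieldOf N h`, `C̃ = fieldOf N C`): the
right side of the coat equation dies against `h`, the Leray symbol drops against the transversal `h k`, the
convection pairing is `∫⟪(c̃·∇)c̃, h̃⟫` by Parseval (`c = C + h`), and antisymmetry of the trilinear form plus the
core's exactness tested against `h̃` reduce it to the production `∫⟪h̃, (h̃·∇)C̃⟫`. [folklore] -/
theorem coat_pairing {N : ℕ} {ν s : ℝ} {C h : ↥(modes (Fin 3) N) → EuclideanSpace ℂ (Fin 3)}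
    (hC : C ∈ galerkinSubspace (modes (Fin 3) N)) (hcore : galerkinRHS (modes (Fin 3) N) 0 0 C = 0)
    (hh : h ∈ galerkinSubspace (modes (Fin 3) N)) (horth : (∑ k, (inner ℂ (C k) (h k)).re) = 0)
    (hs : galerkinRHS (modes (Fin 3) N) ν 0 (C + h) = (-s) • C) :
    dissipation ν h + ν * (4 * Real.pi ^ 2 *
        ∑ k : ↥(modes (Fin 3) N), freqNormSq (k : Fin 3 → ℤ) * (inner ℂ (C k) (h k)).re) =
      -∫ x, ⟪fieldOf N h x, convect (fieldOf N h) (fieldOf N C) x⟫_ℝ := by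
  have hS : ∀ k ∈ modes (Fin 3) N, -k ∈ modes (Fin 3) N := modes_symm N
  have hc : C + h ∈ galerkinSubspace (modes (Fin 3) N) := (galerkinSubspace (modes (Fin 3) N)).add_mem hC hh
  have hCb : IsConjSymm (coeffExt (modes (Fin 3) N) C) := hC.1.isConjSymm_coeffExt hS
  have hcb : IsConjSymm (coeffExt (modes (Fin 3) N) (C + h)) := hc.1.isConjSymm_coeffExt hS
  have hhb : IsConjSymm (coeffExt (modes (Fin 3) N) h) := hh.1.isConjSymm_coeffExt hS
  have hcT : IsTransversal (modes (Fin 3) N) (coeffExt (modes (Fin 3) N) (C + h)) := hc.2.isTransversal_coeffExt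
  have hhT : IsTransversal (modes (Fin 3) N) (coeffExt (modes (Fin 3) N) h) := hh.2.isTransversal_coeffExt
  have hCs : IsSmooth (fieldOf N C) := isSmooth_realTrigPoly _ _
  have hhs : IsSmooth (fieldOf N h) := isSmooth_realTrigPoly _ _
  have hcs : IsSmooth (fieldOf N (C + h)) := isSmooth_realTrigPoly _ _
  have hdivc : IsDivFree (fieldOf N (C + h)) := isDivFree_realTrigPoly hcT
  have hcf : fieldOf N (C + h) = fieldOf N C + fieldOf N h := by
    unfold fieldOf
    rw [coeffExt_add, realTrigPoly_add]
  -- ### coefficients: pair the coat equation with `h`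
  have hpt : ∀ k : ↥(modes (Fin 3) N), (inner ℂ (galerkinRHS (modes (Fin 3) N) ν 0 (C + h) k) (h k)).re =
      -(ν * (4 * Real.pi ^ 2 * freqNormSq (k : Fin 3 → ℤ))) * (inner ℂ ((C + h) k) (h k)).re -
        (inner ℂ (convectionCoeff (modes (Fin 3) N) (coeffExt (modes (Fin 3) N) (C + h))
          (coeffExt (modes (Fin 3) N) (C + h)) k) (h k)).re := by
    intro k
    rw [galerkinRHS_apply, galerkinField_def, coeffExt_zero, Pi.zero_apply, zero_sub, coeffExt_coe, inner_add_left,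
      Complex.add_re, inner_neg_left, Complex.neg_re, inner_leraySym_left_of_transversal _ _ (hh.2 k),
      inner_neg_left, Complex.neg_re, inner_smul_left, Complex.conj_ofReal, Complex.re_ofReal_mul]
    ring
  have hsumR : ∑ k : ↥(modes (Fin 3) N), (inner ℂ (((-s) • C) k) (h k)).re = 0 := by
    have e : ∀ k : ↥(modes (Fin 3) N), (inner ℂ (((-s) • C) k) (h k)).re = -s * (inner ℂ (C k) (h k)).re := by
      intro k
      have e1 : ((-s) • C) k = Complex.ofReal (-s) • C k := by
        rw [Pi.smul_apply, RCLike.real_smul_eq_coe_smul (K := ℂ)]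
        rfl
      rw [e1, inner_smul_left, Complex.conj_ofReal, Complex.re_ofReal_mul]
    rw [Finset.sum_congr rfl fun k _ => e k, ← Finset.mul_sum, horth, mul_zero]
  have hstokes : ∑ k : ↥(modes (Fin 3) N),
      ν * (4 * Real.pi ^ 2 * freqNormSq (k : Fin 3 → ℤ)) * (inner ℂ ((C + h) k) (h k)).re =
      ν * (4 * Real.pi ^ 2 * ∑ k : ↥(modes (Fin 3) N), freqNormSq (k : Fin 3 → ℤ) * (inner ℂ (C k) (h k)).re) +
        dissipation ν h := by
    have e : ∀ k : ↥(modes (Fin 3) N), ν * (4 * Real.pi ^ 2 * freqNormSq (k : Fin 3 → ℤ)) * (inner ℂ ((C + h) k) (h k)).re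
        = ν * (4 * Real.pi ^ 2) * (freqNormSq (k : Fin 3 → ℤ) * (inner ℂ (C k) (h k)).re) +
          ν * (4 * Real.pi ^ 2) * (freqNormSq (k : Fin 3 → ℤ) * ‖h k‖ ^ 2) := by
      intro k
      have hhh : (inner ℂ (h k) (h k)).re = ‖h k‖ ^ 2 := inner_self_eq_norm_sq (𝕜 := ℂ) (h k)
      rw [Pi.add_apply, inner_add_left, Complex.add_re, hhh]
      ring
    rw [Finset.sum_congr rfl fun k _ => e k, Finset.sum_add_distrib, ← Finset.mul_sum, ← Finset.mul_sum]
    unfold dissipation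
    ring
  have hstep1 : dissipation ν h + ν * (4 * Real.pi ^ 2 *
      ∑ k : ↥(modes (Fin 3) N), freqNormSq (k : Fin 3 → ℤ) * (inner ℂ (C k) (h k)).re) =
      -∑ k : ↥(modes (Fin 3) N), (inner ℂ (convectionCoeff (modes (Fin 3) N) (coeffExt (modes (Fin 3) N) (C + h))
        (coeffExt (modes (Fin 3) N) (C + h)) k) (h k)).re := by
    have hsum := hsumR
    rw [← hs, Finset.sum_congr rfl fun k _ => hpt k, Finset.sum_sub_distrib] at hsum
    have hneg : ∑ k : ↥(modes (Fin 3) N),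
        -(ν * (4 * Real.pi ^ 2 * freqNormSq (k : Fin 3 → ℤ))) * (inner ℂ ((C + h) k) (h k)).re =
        -(ν * (4 * Real.pi ^ 2 * ∑ k : ↥(modes (Fin 3) N), freqNormSq (k : Fin 3 → ℤ) * (inner ℂ (C k) (h k)).re) +
          dissipation ν h) := by
      rw [← hstokes, ← Finset.sum_neg_distrib]
      refine Finset.sum_congr rfl fun k _ => ?_
      ring
    rw [hneg] at hsum
    linarith
  -- ### Parseval against the band-limited `h̃`
  have hstep2 : ∑ k : ↥(modes (Fin 3) N),
      (inner ℂ (convectionCoeff (modes (Fin 3) N) (coeffExt (modes (Fin 3) N) (C + h))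
        (coeffExt (modes (Fin 3) N) (C + h)) k) (h k)).re =
      ∫ x, ⟪convect (fieldOf N (C + h)) (fieldOf N (C + h)) x, fieldOf N h x⟫_ℝ := by
    unfold fieldOf at hcs ⊢
    rw [integral_inner_realTrigPoly_right hS hhb ((hcs.convect hcs).memLp 2),
      ← sum_coeffExt (fun k v => (inner ℂ (convectionCoeff (modes (Fin 3) N) (coeffExt (modes (Fin 3) N) (C + h))
        (coeffExt (modes (Fin 3) N) (C + h)) k) v).re) h]
    refine Finset.sum_congr rfl fun k _ => ?_
    rw [mFourierCoeff_convect_realTrigPoly hS hcb hcb]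
  -- ### fields: antisymmetry and the core's exactness
  have hI1 := integral_inner_convect_eq_neg hcs hdivc hcs hhs
  have hI2 : ∫ x, ⟪fieldOf N (C + h) x, convect (fieldOf N (C + h)) (fieldOf N h) x⟫_ℝ =
      (∫ x, ⟪fieldOf N C x, convect (fieldOf N (C + h)) (fieldOf N h) x⟫_ℝ) +
        ∫ x, ⟪fieldOf N h x, convect (fieldOf N (C + h)) (fieldOf N h) x⟫_ℝ := by
    rw [← integral_add (hCs.inner (hcs.convect hhs)).integrable (hhs.inner (hcs.convect hhs)).integrable]
    refine integral_congr_ae (ae_of_all _ fun x => ?_)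
    show ⟪fieldOf N (C + h) x, convect (fieldOf N (C + h)) (fieldOf N h) x⟫_ℝ =
      ⟪fieldOf N C x, convect (fieldOf N (C + h)) (fieldOf N h) x⟫_ℝ +
        ⟪fieldOf N h x, convect (fieldOf N (C + h)) (fieldOf N h) x⟫_ℝ
    rw [hcf, Pi.add_apply, inner_add_left]
  have hI3 : ∫ x, ⟪fieldOf N h x, convect (fieldOf N (C + h)) (fieldOf N h) x⟫_ℝ = 0 := by
    have h2 := integral_inner_convect_add_eq_zero hcs hdivc hhs hhs
    have hsym : ∫ x, ⟪convect (fieldOf N (C + h)) (fieldOf N h) x, fieldOf N h x⟫_ℝ =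
        ∫ x, ⟪fieldOf N h x, convect (fieldOf N (C + h)) (fieldOf N h) x⟫_ℝ :=
      integral_congr_ae (ae_of_all _ fun x => real_inner_comm _ _)
    rw [hsym] at h2
    linarith
  have hI4 := integral_inner_convect_eq_neg hcs hdivc hCs hhs
  have hI5 : ∫ x, ⟪convect (fieldOf N (C + h)) (fieldOf N C) x, fieldOf N h x⟫_ℝ =
      (∫ x, ⟪convect (fieldOf N C) (fieldOf N C) x, fieldOf N h x⟫_ℝ) +
        ∫ x, ⟪convect (fieldOf N h) (fieldOf N C) x, fieldOf N h x⟫_ℝ := by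
    rw [← integral_add ((hCs.convect hCs).inner hhs).integrable ((hhs.convect hCs).inner hhs).integrable]
    refine integral_congr_ae (ae_of_all _ fun x => ?_)
    have hadd : convect (fieldOf N (C + h)) (fieldOf N C) x =
        convect (fieldOf N C) (fieldOf N C) x + convect (fieldOf N h) (fieldOf N C) x := by
      show Torus.fderiv (fieldOf N C) x (fieldOf N (C + h) x) =
        Torus.fderiv (fieldOf N C) x (fieldOf N C x) + Torus.fderiv (fieldOf N C) x (fieldOf N h x)
      rw [hcf, Pi.add_apply, map_add]
    show ⟪convect (fieldOf N (C + h)) (fieldOf N C) x, fieldOf N h x⟫_ℝ =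
      ⟪convect (fieldOf N C) (fieldOf N C) x, fieldOf N h x⟫_ℝ + ⟪convect (fieldOf N h) (fieldOf N C) x, fieldOf N h x⟫_ℝ
    rw [hadd, inner_add_left]
  -- the core's exactness tested against `h̃`: `∫⟪(C̃·∇)C̃, h̃⟫ = 0`
  have hI6 : ∫ x, ⟪convect (fieldOf N C) (fieldOf N C) x, fieldOf N h x⟫_ℝ = 0 := by
    unfold fieldOf at hCs ⊢
    rw [integral_inner_realTrigPoly_right hS hhb ((hCs.convect hCs).memLp 2)]
    refine Finset.sum_eq_zero fun k hk => ?_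
    rw [mFourierCoeff_convect_realTrigPoly hS hCb hCb, ← inner_leraySym_left_of_transversal _ _ (hhT k hk)]
    have h0 := congrFun hcore ⟨k, hk⟩
    rw [galerkinRHS_apply, galerkinField_def, coeffExt_zero, Pi.zero_apply, Pi.zero_apply, zero_sub, leraySym_neg]
      at h0
    simp only [zero_mul, Complex.ofReal_zero, zero_smul, neg_zero, zero_add, neg_eq_zero] at h0
    rw [h0, inner_zero_left, Complex.zero_re]
  have hI7 : ∫ x, ⟪convect (fieldOf N h) (fieldOf N C) x, fieldOf N h x⟫_ℝ =
      ∫ x, ⟪fieldOf N h x, convect (fieldOf N h) (fieldOf N C) x⟫_ℝ :=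
    integral_congr_ae (ae_of_all _ fun x => real_inner_comm _ _)
  rw [hstep1, hstep2, hI1, hI2, hI3, add_zero, neg_neg]
  linarith [hI4, hI5, hI6, hI7]

/-! ## §2 The explicit `ℓ¹` strain bound -/

/-- **Strain bound for a real trigonometric polynomial**: `‖(u·∇)(realTrigPoly S c)(x)‖ ≤ (2π ∑_{k∈S} |k| ‖c k‖) ‖u x‖`
(`D(realTrigPoly S c)(x)[w] = ∑ᵢ wᵢ ∂ᵢ`, `∂ᵢ realTrigPoly S c = realTrigPoly S ((2πi kᵢ) • c k)`, the pointwise bound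
`‖realTrigPoly S c' x‖ ≤ ∑ ‖c' k‖`, and Cauchy–Schwarz `∑ᵢ |wᵢ| |kᵢ| ≤ ‖w‖ |k|`). [folklore] -/
theorem norm_convect_realTrigPoly_le (S : Finset (Fin 3 → ℤ)) (c : (Fin 3 → ℤ) → EuclideanSpace ℂ (Fin 3))
    (u : UnitAddTorus (Fin 3) → EuclideanSpace ℝ (Fin 3)) (x : UnitAddTorus (Fin 3)) :
    ‖convect u (realTrigPoly S c) x‖ ≤ (2 * Real.pi * ∑ k ∈ S, Real.sqrt (freqNormSq k) * ‖c k‖) * ‖u x‖ := by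
  have hf : IsContDiff 1 (realTrigPoly S c) := (isSmooth_realTrigPoly S c).isContDiff (by simp)
  have hexp : convect u (realTrigPoly S c) x = ∑ i, u x i • partialDeriv i (realTrigPoly S c) x :=
    fderiv_apply_eq_sum_partialDeriv hf x (u x)
  -- each partial derivative is a trigonometric polynomial with coefficients `(2πi kᵢ) • c k`
  have hpd : ∀ i, ‖partialDeriv i (realTrigPoly S c) x‖ ≤ ∑ k ∈ S, 2 * Real.pi * |(k i : ℝ)| * ‖c k‖ := by
    intro i
    rw [partialDeriv_realTrigPoly]
    refine (norm_realTrigPoly_apply_le _ _ _).trans (le_of_eq ?_)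
    refine Finset.sum_congr rfl fun k _ => ?_
    rw [norm_smul]
    congr 1
    rw [norm_mul, norm_mul, norm_mul, Complex.norm_I, mul_one, Complex.norm_real, Real.norm_eq_abs,
      abs_of_pos Real.pi_pos, Complex.norm_intCast, Complex.norm_ofNat]
  -- Cauchy–Schwarz in the coordinate index
  have hCS : ∀ k : Fin 3 → ℤ, ∑ i, |u x i| * |(k i : ℝ)| ≤ ‖u x‖ * Real.sqrt (freqNormSq k) := by
    intro k
    refine (Real.sum_mul_le_sqrt_mul_sqrt _ _ _).trans (le_of_eq ?_)
    congr 1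
    · simp only [EuclideanSpace.norm_eq, Real.norm_eq_abs, sq_abs]
    · simp only [freqNormSq, sq_abs]
  calc ‖convect u (realTrigPoly S c) x‖
      = ‖∑ i, u x i • partialDeriv i (realTrigPoly S c) x‖ := by rw [hexp]
    _ ≤ ∑ i, |u x i| * ‖partialDeriv i (realTrigPoly S c) x‖ := by
        refine (norm_sum_le _ _).trans (Finset.sum_le_sum fun i _ => ?_)
        rw [norm_smul, Real.norm_eq_abs]
    _ ≤ ∑ i, |u x i| * ∑ k ∈ S, 2 * Real.pi * |(k i : ℝ)| * ‖c k‖ :=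
        Finset.sum_le_sum fun i _ => mul_le_mul_of_nonneg_left (hpd i) (abs_nonneg _)
    _ = 2 * Real.pi * ∑ k ∈ S, ‖c k‖ * ∑ i, |u x i| * |(k i : ℝ)| := by
        rw [Finset.mul_sum]
        simp_rw [Finset.mul_sum]
        rw [Finset.sum_comm]
        refine Finset.sum_congr rfl fun k _ => Finset.sum_congr rfl fun i _ => ?_
        ring
    _ ≤ 2 * Real.pi * ∑ k ∈ S, ‖c k‖ * (‖u x‖ * Real.sqrt (freqNormSq k)) := by
        refine mul_le_mul_of_nonneg_left (Finset.sum_le_sum fun k _ => ?_) (by positivity)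
        exact mul_le_mul_of_nonneg_left (hCS k) (norm_nonneg _)
    _ = (2 * Real.pi * ∑ k ∈ S, Real.sqrt (freqNormSq k) * ‖c k‖) * ‖u x‖ := by
        rw [Finset.mul_sum, Finset.mul_sum, Finset.sum_mul]
        refine Finset.sum_congr rfl fun k _ => ?_
        ring

/-! ## §3 B2: the coat window -/

/-- **B2 `coat_window`** (tightness; GENERAL exact Euler core `C = Cfun|modes N`, `supp Cfun ⊆ modes K₀`, `K₀ ≤ N`).
For an amplitude-clamped coat `h ⊥ C` at clamp viscosity `ν ≥ 0`: `energy (C + h) = energy C + energy h`, and the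
TOTAL dissipation is at most the production ceiling plus `O(ν)`:
`dissipation ν (C + h) ≤ (2π ∑_{modes K₀} |k| ‖Cfun k‖) · energy h + 2ν·4π²K₀² (√(energy C) + √(energy h))²`
(`coat_pairing` + the strain bound `norm_convect_realTrigPoly_le` + Parseval for the production term; `|k|² ≤ K₀²` on
the core's support and Cauchy–Schwarz for the Stokes cross terms).  Consequences: the instant budget check
`ε₁ ≤ strainBound·(E₁ − E_C) + 16π²K₀²·ρνlo·E₁` (K-1) and "no small loud coats". [folklore] -/
theorem coat_window (K₀ N : ℕ) (hKN : K₀ ≤ N) (Cfun : (Fin 3 → ℤ) → EuclideanSpace ℂ (Fin 3))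
    (hsupp : ∀ k ∉ modes (Fin 3) K₀, Cfun k = 0) (C h : ↥(modes (Fin 3) N) → EuclideanSpace ℂ (Fin 3))
    (hCdef : C = fun k : ↥(modes (Fin 3) N) => Cfun k)
    (hC : C ∈ galerkinSubspace (modes (Fin 3) N)) (hcore : galerkinRHS (modes (Fin 3) N) 0 0 C = 0)
    (ν s : ℝ) (hν : 0 ≤ ν) (hh : h ∈ galerkinSubspace (modes (Fin 3) N))
    (horth : (∑ k, (inner ℂ (C k) (h k)).re) = 0)
    (hs : galerkinRHS (modes (Fin 3) N) ν 0 (C + h) = (-s) • C) :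
    energy (C + h) = energy C + energy h ∧
      dissipation ν (C + h) ≤ (2 * Real.pi * ∑ k ∈ modes (Fin 3) K₀, Real.sqrt (freqNormSq k) * ‖Cfun k‖) * energy h +
        2 * ν * (4 * Real.pi ^ 2 * (K₀ : ℝ) ^ 2) * (Real.sqrt (energy C) + Real.sqrt (energy h)) ^ 2 := by
  have hmodes_mono : modes (Fin 3) K₀ ⊆ modes (Fin 3) N := fun k hk => by
    rw [Finset.mem_erase] at hk ⊢
    exact ⟨hk.1, freqBall_mono hKN hk.2⟩
  -- pointwise expansion of `‖C k + h k‖²`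
  have hsq : ∀ k : ↥(modes (Fin 3) N), ‖(C + h) k‖ ^ 2 = ‖C k‖ ^ 2 + 2 * (inner ℂ (C k) (h k)).re + ‖h k‖ ^ 2 := by
    intro k
    rw [Pi.add_apply]
    exact norm_add_sq (𝕜 := ℂ) (C k) (h k)
  have hE : energy (C + h) = energy C + energy h := by
    unfold energy
    rw [Finset.sum_congr rfl fun k _ => hsq k, Finset.sum_add_distrib, Finset.sum_add_distrib, ← Finset.mul_sum,
      horth, mul_zero, add_zero]
  refine ⟨hE, ?_⟩
  -- abbreviations (opaque)
  obtain ⟨X, hXdef⟩ : ∃ X : ℝ, X = ∑ k : ↥(modes (Fin 3) N), freqNormSq (k : Fin 3 → ℤ) * (inner ℂ (C k) (h k)).re :=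
    ⟨_, rfl⟩
  obtain ⟨P, hPdef⟩ : ∃ P : ℝ, P = ∫ x, ⟪fieldOf N h x, convect (fieldOf N h) (fieldOf N C) x⟫_ℝ := ⟨_, rfl⟩
  obtain ⟨sB, hsBdef⟩ : ∃ sB : ℝ, sB = 2 * Real.pi * ∑ k ∈ modes (Fin 3) K₀, Real.sqrt (freqNormSq k) * ‖Cfun k‖ :=
    ⟨_, rfl⟩
  rw [← hsBdef]
  have hpair : dissipation ν h + ν * (4 * Real.pi ^ 2 * X) = -P := by
    rw [hXdef, hPdef]
    exact coat_pairing hC hcore hh horth hs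
  -- the total dissipation, expanded
  have hD : dissipation ν (C + h) = dissipation ν C + 2 * (ν * (4 * Real.pi ^ 2 * X)) + dissipation ν h := by
    have hexp : ∑ k : ↥(modes (Fin 3) N), freqNormSq (k : Fin 3 → ℤ) * ‖(C + h) k‖ ^ 2 =
        ∑ k : ↥(modes (Fin 3) N), freqNormSq (k : Fin 3 → ℤ) * ‖C k‖ ^ 2 + 2 * X +
          ∑ k : ↥(modes (Fin 3) N), freqNormSq (k : Fin 3 → ℤ) * ‖h k‖ ^ 2 := by
      rw [hXdef, Finset.mul_sum, ← Finset.sum_add_distrib, ← Finset.sum_add_distrib]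
      refine Finset.sum_congr rfl fun k _ => ?_
      rw [hsq k]
      ring
    unfold dissipation
    rw [hexp]
    ring
  -- on the core's support `|k|² ≤ K₀²`
  have hkC : ∀ k : ↥(modes (Fin 3) N), C k ≠ 0 → freqNormSq (k : Fin 3 → ℤ) ≤ (K₀ : ℝ) ^ 2 := by
    intro k hk
    have hkK : (k : Fin 3 → ℤ) ∈ modes (Fin 3) K₀ := by
      by_contra hnot
      exact hk (by rw [hCdef]; exact hsupp _ hnot)
    exact freqNormSq_le_of_mem_modes hkK
  -- (i) the core's own dissipation
  have hDC : dissipation ν C ≤ ν * (4 * Real.pi ^ 2 * (K₀ : ℝ) ^ 2) * energy C := by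
    have hsum : ∑ k : ↥(modes (Fin 3) N), freqNormSq (k : Fin 3 → ℤ) * ‖C k‖ ^ 2 ≤ (K₀ : ℝ) ^ 2 * energy C := by
      unfold energy
      rw [Finset.mul_sum]
      refine Finset.sum_le_sum fun k _ => ?_
      by_cases hk : C k = 0
      · rw [hk, norm_zero]
        simp
      · exact mul_le_mul_of_nonneg_right (hkC k hk) (sq_nonneg _)
    unfold dissipation
    calc ν * (4 * Real.pi ^ 2 * ∑ k : ↥(modes (Fin 3) N), freqNormSq (k : Fin 3 → ℤ) * ‖C k‖ ^ 2)
        ≤ ν * (4 * Real.pi ^ 2 * ((K₀ : ℝ) ^ 2 * energy C)) :=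
          mul_le_mul_of_nonneg_left (mul_le_mul_of_nonneg_left hsum (by positivity)) hν
      _ = ν * (4 * Real.pi ^ 2 * (K₀ : ℝ) ^ 2) * energy C := by ring
  -- (ii) the Stokes cross term
  have hXle : |X| ≤ (K₀ : ℝ) ^ 2 * (Real.sqrt (energy C) * Real.sqrt (energy h)) := by
    have h1 : |X| ≤ ∑ k : ↥(modes (Fin 3) N), (K₀ : ℝ) ^ 2 * (‖C k‖ * ‖h k‖) := by
      rw [hXdef]
      refine (Finset.abs_sum_le_sum_abs _ _).trans (Finset.sum_le_sum fun k _ => ?_)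
      by_cases hk : C k = 0
      · rw [hk, inner_zero_left, Complex.zero_re, mul_zero, abs_zero, norm_zero, zero_mul, mul_zero]
      · rw [abs_mul, abs_of_nonneg (freqNormSq_nonneg _)]
        refine mul_le_mul (hkC k hk) ?_ (abs_nonneg _) (by positivity)
        exact (Complex.abs_re_le_norm _).trans (norm_inner_le_norm (C k) (h k))
    refine h1.trans ?_
    rw [← Finset.mul_sum]
    refine mul_le_mul_of_nonneg_left ?_ (by positivity)
    have hcs := Real.sum_mul_le_sqrt_mul_sqrt (Finset.univ : Finset ↥(modes (Fin 3) N)) (fun k => ‖C k‖) fun k => ‖h k‖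
    exact hcs
  -- (iii) the production term: `-P ≤ sB · energy h`
  have hext : coeffExt (modes (Fin 3) N) C = Cfun := by
    funext k
    by_cases hk : k ∈ modes (Fin 3) N
    · rw [coeffExt_of_mem _ hk, hCdef]
    · rw [coeffExt_of_not_mem _ hk, hsupp k fun hk' => hk (hmodes_mono hk')]
  have hsB' : 2 * Real.pi * ∑ k ∈ modes (Fin 3) N, Real.sqrt (freqNormSq k) * ‖coeffExt (modes (Fin 3) N) C k‖ = sB := by
    rw [hsBdef, hext]
    congr 1
    symm
    refine Finset.sum_subset hmodes_mono fun k _ hk => ?_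
    rw [hsupp k hk, norm_zero, mul_zero]
  have hsB0 : 0 ≤ sB := by
    rw [hsBdef]
    exact mul_nonneg (mul_nonneg zero_le_two Real.pi_pos.le)
      (Finset.sum_nonneg fun k _ => mul_nonneg (Real.sqrt_nonneg _) (norm_nonneg _))
  have hhs : IsSmooth (fieldOf N h) := isSmooth_realTrigPoly _ _
  have hCs : IsSmooth (fieldOf N C) := isSmooth_realTrigPoly _ _
  have hptw : ∀ x : UnitAddTorus (Fin 3),
      -⟪fieldOf N h x, convect (fieldOf N h) (fieldOf N C) x⟫_ℝ ≤ sB * ‖fieldOf N h x‖ ^ 2 := by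
    intro x
    have hcv : ‖convect (fieldOf N h) (fieldOf N C) x‖ ≤ sB * ‖fieldOf N h x‖ := by
      have hle := norm_convect_realTrigPoly_le (modes (Fin 3) N) (coeffExt (modes (Fin 3) N) C) (fieldOf N h) x
      rw [hsB'] at hle
      exact hle
    calc -⟪fieldOf N h x, convect (fieldOf N h) (fieldOf N C) x⟫_ℝ
        ≤ |⟪fieldOf N h x, convect (fieldOf N h) (fieldOf N C) x⟫_ℝ| := neg_le_abs _
      _ ≤ ‖fieldOf N h x‖ * ‖convect (fieldOf N h) (fieldOf N C) x‖ := abs_real_inner_le_norm _ _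
      _ ≤ ‖fieldOf N h x‖ * (sB * ‖fieldOf N h x‖) := mul_le_mul_of_nonneg_left hcv (norm_nonneg _)
      _ = sB * ‖fieldOf N h x‖ ^ 2 := by ring
  have hPle : -P ≤ sB * energy h := by
    have hint : ∫ x, -⟪fieldOf N h x, convect (fieldOf N h) (fieldOf N C) x⟫_ℝ ≤ ∫ x, sB * ‖fieldOf N h x‖ ^ 2 :=
      integral_mono (f := fun x => -⟪fieldOf N h x, convect (fieldOf N h) (fieldOf N C) x⟫_ℝ)
        (g := fun x => sB * ‖fieldOf N h x‖ ^ 2) (hhs.inner (hhs.convect hCs)).integrable.neg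
        (((hhs.continuous.norm.pow 2).integrable_unitAddTorus).const_mul sB) fun x => hptw x
    rw [integral_neg, integral_const_mul, integral_norm_sq_fieldOf hh] at hint
    rw [hPdef]
    exact hint
  -- assemble
  have hEC := energy_nonneg C
  have hEh := energy_nonneg h
  have hsqC := Real.sqrt_nonneg (energy C)
  have hsqh := Real.sqrt_nonneg (energy h)
  have h4π : (0 : ℝ) ≤ 4 * Real.pi ^ 2 := mul_nonneg (by norm_num) (sq_nonneg _)
  have hK : 0 ≤ ν * (4 * Real.pi ^ 2 * (K₀ : ℝ) ^ 2) := mul_nonneg hν (mul_nonneg h4π (sq_nonneg _))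
  have hX2 : ν * (4 * Real.pi ^ 2 * X) ≤ ν * (4 * Real.pi ^ 2 * (K₀ : ℝ) ^ 2) *
      (Real.sqrt (energy C) * Real.sqrt (energy h)) := by
    have hXa := (le_abs_self X).trans hXle
    calc ν * (4 * Real.pi ^ 2 * X) ≤ ν * (4 * Real.pi ^ 2 * ((K₀ : ℝ) ^ 2 * (Real.sqrt (energy C) * Real.sqrt (energy h)))) :=
          mul_le_mul_of_nonneg_left (mul_le_mul_of_nonneg_left hXa h4π) hν
      _ = _ := by ring
  have hDh : dissipation ν h = -P - ν * (4 * Real.pi ^ 2 * X) := by linarith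
  have hexpand : (Real.sqrt (energy C) + Real.sqrt (energy h)) ^ 2 =
      energy C + 2 * (Real.sqrt (energy C) * Real.sqrt (energy h)) + energy h := by
    rw [add_sq, Real.sq_sqrt hEC, Real.sq_sqrt hEh]
    ring
  rw [hD, hDh, hexpand]
  have h1 := mul_nonneg hK hEC
  have h2 := mul_nonneg hK (mul_nonneg hsqC hsqh)
  have h3 := mul_nonneg hK hEh
  linarith [hDC, hX2, hPle, h1, h2, h3]

/-- **stub_loudCoatWindowTools** (REGISTERED sub-goal of the line `idea-sketch-ideator2`: tier B of the stub plan for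
`stub_loudCoatDecades`, lemma B2 with the plan's `strainBound` inlined).  Packaging of `coat_window`. [folklore] -/
theorem stub_loudCoatWindowTools : ∀ (K₀ N : ℕ) (Cfun : (Fin 3 → ℤ) → EuclideanSpace ℂ (Fin 3)) (C h : ↥(modes (Fin 3) N) → EuclideanSpace ℂ (Fin 3)) (ν s : ℝ), K₀ ≤ N → (∀ k ∉ modes (Fin 3) K₀, Cfun k = 0) → (C = fun k : ↥(modes (Fin 3) N) => Cfun k) → C ∈ galerkinSubspace (modes (Fin 3) N) → galerkinRHS (modes (Fin 3) N) 0 0 C = 0 → 0 ≤ ν → h ∈ galerkinSubspace (modes (Fin 3) N) → (∑ k, (inner ℂ (C k) (h k)).re) = 0 → galerkinRHS (modes (Fin 3) N) ν 0 (C + h) = (-s) • C → energy (C + h) = energy C + energy h ∧ dissipation ν (C + h) ≤ (2 * Real.pi * ∑ k ∈ modes (Fin 3) K₀, Real.sqrt (freqNormSq k) * ‖Cfun k‖) * energy h + 2 * ν * (4 * Real.pi ^ 2 * (K₀ : ℝ) ^ 2) * (Real.sqrt (energy C) + Real.sqrt (energy h)) ^ 2 :=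
  fun K₀ N Cfun C h ν s hKN hsupp hCdef hC hcore hν hh horth hs =>
    coat_window K₀ N hKN Cfun hsupp C h hCdef hC hcore ν s hν hh horth hs

end Summit.AnomalousDissipation.AnomalousDissipation.Theorems.GalerkinSteadyZerothLaw

end

-- buildfix 2026-08-20 (ops-buildfix-1 gen 7): enqueue-only re-land — rebuild after B-35 (StokesArc, p233893) healed this module's import closure; no declaration changed.
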